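import Mathlib
import Literature.NumberTheory.LFunctions.Zhang2022.Section17Eq172Extension
import Literature.NumberTheory.LFunctions.Zhang2022.Section14Prop141Discharge
import Literature.NumberTheory.LFunctions.Zhang2022.Section14Eq143Assembly
import Literature.NumberTheory.LFunctions.Zhang2022.Section4Prop22Eventually
import Literature.NumberTheory.LFunctions.Zhang2022.Section17Eval1710Rel
import Literature.NumberTheory.LFunctions.Zhang2022.TypedSection17Rel
import Literature.NumberTheory.LFunctions.Zhang2022.TypedSection17Identities
import HarnessLib

/-!
# Zhang (2022) §17 (17.2) HOLDS: `Σ_{ψ∈Ψ₁}(p_ψt₀)^{β₃}I₄⁺(ψ) = Σ_{p∼P}(pt₀)^{β₃}Φ₃⁺(p) + o(𝔓)`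

Topic `Literature/NumberTheory/LFunctions/Zhang2022` (Landau–Siegel audit tree; verdict-neutral).
Y. Zhang, *Discrete mean estimates and the Landau–Siegel zero*, arXiv:2211.02515v1 (2022)
[Zhang2022LandauSiegel] — **an unrefereed manuscript under adjudication**; nothing here asserts or
denies its Theorems 1–2. DAG node `Z22:(17.2)` [Z22 p.95, (17.2), tex L4711–L4716]:

> "To treat the sum of `I₄⁺(ψ)` we move the segment `𝔍(α)` to `𝔍(1)`, and then extend the sum over
> `Ψ₁` to the sum over `Ψ` with an acceptable error. Hence
> `Σ_{ψ∈Ψ₁}(p_ψt₀)^{β₃}I₄⁺(ψ) = Σ_{p∼P}(pt₀)^{β₃}Φ₃⁺(p) + o(𝔓)`."  (17.2)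

PROVED here, for every `c′` (UNCONDITIONAL): `Typed.Section17.eq17_2_holds : ∀ c′, Eq17_2 c′`, the
typed node BY NAME. Assembly of three kernel pieces: (a) the move `𝔍(α) → 𝔍(1)` on `Ψ₁`
(`Eq172.eq17_2a_of_prop22i`, `Section17Eq172Shift`, from Proposition 2.2 (i) = the tree's
`Skeleton.prop22i_holds`); (b) the extension error `‖Σ_{ψ∈Ψ₂}(p_ψt₀)^{β₃}(1/2πi)∫_{𝔍(1)}𝔨₃ω‖ ≤ ε𝔓`
(`Eq172.norm_sum_PsiTwo_weighted_le`, `Section17Eq172Extension`: the (7.5)/(14.3) method — Hölder,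
Lemma 3.3 (ii), Proposition 2.1, both tree theorems); (c) the regrouping
`Σ_{ψ∈Ψ}(p_ψt₀)^{β₃}(1/2πi)∫_{𝔍(1)}𝔨₃ω = Σ_{p∼P}(pt₀)^{β₃}Φ₃⁺(p)` (`Ψ = Ψ₁ ⊔ Ψ₂`, `Σ_Ψ = Σ_{p∼P}Σ*_{ψ (mod p)}`,
`Typed.Sec14.Eq143.sum_finsetOf_univ_eq`, `Typed.Sec14.sum_finsetOf_univ_eq_sum_primeWindow`; `Φ₃⁺(p)` = `Typed.Section17.Phi3plus`). The
`O(e^{−𝓛¹⁰/16})` of (a) is `≤ (ε/2)𝔓` for large `D` since `𝔓 ≥ D` (`Phi3Eval.forAllLarge_self_le_frakP`).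

Theorems only; no definitions, no named facts; axioms standard. ZHANG-L discharge lane (WP16, seat
zl-w16-p6), toward the leaf `Typed.Section17.Eq17_6Rel` of `Skeleton.theorem1_of_leaves_v19`: with (17.2)
a theorem, the tree's edges `Phi3Eval.eq17_6_of : Eq17_2 → Eq17_5 → Eq17_6`, `eq17_5_of : Step17_u007 →
(∀ Step17_u008) → Eq17_5`, `eq17_6Rel_of_eq17_6` reduce the leaf to the single node §17.u007 (recorded
below as `eq17_6Rel_of_step17_u007`). WHAT THIS IS NOT: a proof of §17.u007 ("a detailed analysis
shows …"), or any claim about Theorems 1–2 of the source or Landau–Siegel zeros.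

## References

* Y. Zhang, arXiv:2211.02515v1 (2022), §17 (17.2) p.95 (tex L4711–L4716), (17.5)–(17.6) p.96; §7
  (7.3)–(7.5) pp.34–35; §2 Prop. 2.1, Prop. 2.2 (i), (2.9). [cite: Zhang2022LandauSiegel, §17 (17.2) p.95]
-/

noncomputable section

open Finset Complex Real
open Literature.NumberTheory.LFunctions.Zhang2022.Skeleton
open Literature.NumberTheory.LFunctions.Zhang2022.Typed.Section17

namespace Literature.NumberTheory.LFunctions.Zhang2022.Eq172

/-! ## Bookkeeping: `Ψ = Ψ₁ ⊔ Ψ₂` and `Σ_Ψ = Σ_{p∼P} Σ*_{ψ (mod p)}` -/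

/-- **`Σ_{ψ∈Ψ}(p_ψt₀)^{β₃}(1/2πi)∫_{𝔍(1)}𝔨₃(s,ψ)ω(s)ds = Σ_{p∼P}(pt₀)^{β₃}Φ₃⁺(p)`**
(`Φ₃⁺(p) = Σ*_{ψ (mod p)}(1/2πi)∫_{𝔍(1)}𝔨₃ω`, §17 p.95 "where …"). [cite: Zhang2022LandauSiegel, §17 u003 p.95] -/
theorem sum_univ_weighted_segInt_eq_sum_Phi3plus (c' : ℝ) {D : ℕ} [NeZero D] (χ : DirichletCharacter ℂ D) :
    ∑ x ∈ finsetOf (Set.univ : Set (Chr D)), (((x.p : ℝ) * t0 D : ℝ) : ℂ) ^ beta3 c' D *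
        Lemma81.segInt (t0 D) (ell1 D) 1 (fun s => kfrak3 c' χ x s * omegaW D s) =
      ∑ p ∈ primeWindow D, (((p : ℝ) * t0 D : ℝ) : ℂ) ^ beta3 c' D * Phi3plus c' χ p := by
  rw [Typed.Sec14.sum_finsetOf_univ_eq_sum_primeWindow]
  refine Finset.sum_congr rfl fun p _ => ?_
  rw [Phi3plus, chrMod, Finset.mul_sum]
  refine Finset.sum_congr rfl fun x hx => ?_
  have hx' : x.p = p := by
    have := mem_of_mem_finsetOf hx
    simpa using this
  rw [hx']

/-! ## (17.2) -/

/-- **(17.2) HOLDS** (every `c′`): "`Σ_{ψ∈Ψ₁}(p_ψt₀)^{β₃}I₄⁺(ψ) = Σ_{p∼P}(pt₀)^{β₃}Φ₃⁺(p) + o(𝔓)`" —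
the typed node `Typed.Section17.Eq17_2 c′` BY NAME. From the contour move on `Ψ₁`
(`eq17_2a_of_prop22i` at `Skeleton.prop22i_holds`, error `≤ Ce^{−𝓛¹⁰/16} ≤ (ε/2)𝔓`), the
extension error over `Ψ₂` (`norm_sum_PsiTwo_weighted_le`, `≤ (ε/2)𝔓`), and the regrouping
`sum_univ_weighted_segInt_eq_sum_Phi3plus`. [cite: Zhang2022LandauSiegel, §17 (17.2) p.95, tex L4711–L4716] -/
theorem eq17_2_holds (c' : ℝ) : Eq17_2 c' := by
  intro ε hε
  have hε2 : 0 < ε / 2 := by positivity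
  obtain ⟨c, hc, C, ha⟩ := eq17_2a_of_prop22i prop22i_holds c'
  have hb := norm_sum_PsiTwo_weighted_le c' (ε / 2) hε2
  -- `C e^{−c𝓛¹⁰} ≤ (ε/2) D ≤ (ε/2)𝔓` for large `D`
  obtain ⟨D₁, hD₁⟩ := const_mul_ell_pow_le_self 0 (2 * max C 0 / ε)
  refine (((ha.and hb).and Phi3Eval.forAllLarge_self_le_frakP).and
    (ForAllLarge.of_le D₁ (S := fun D _ _ => D₁ ≤ D) fun _ _ _ hD _ _ => hD)).mono ?_
  intro D _ χ hq hp h hA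
  obtain ⟨⟨⟨haD, hbD⟩, hPD⟩, hD₁'⟩ := h
  have haD := haD hA
  have hbD := hbD hA
  have hkey : 2 * max C 0 / ε ≤ D := by have := hD₁ D hD₁'; simpa using this
  set S₁ : ℂ := ∑ x ∈ finsetOf (PsiOne χ), (((x.p : ℝ) * t0 D : ℝ) : ℂ) ^ beta3 c' D *
    I4 c' χ x (alpha D) with hS₁
  set J₁ : ℂ := ∑ x ∈ finsetOf (PsiOne χ), (((x.p : ℝ) * t0 D : ℝ) : ℂ) ^ beta3 c' D *
    Lemma81.segInt (t0 D) (ell1 D) 1 (fun s => kfrak3 c' χ x s * omegaW D s) with hJ₁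
  set J₂ : ℂ := ∑ x ∈ finsetOf (PsiTwo χ), (((x.p : ℝ) * t0 D : ℝ) : ℂ) ^ beta3 c' D *
    Lemma81.segInt (t0 D) (ell1 D) 1 (fun s => kfrak3 c' χ x s * omegaW D s) with hJ₂
  set T : ℂ := ∑ p ∈ primeWindow D, (((p : ℝ) * t0 D : ℝ) : ℂ) ^ beta3 c' D * Phi3plus c' χ p with hT
  have hreg : J₁ + J₂ = T := by
    rw [hJ₁, hJ₂, hT, ← Typed.Sec14.Eq143.sum_finsetOf_univ_eq, sum_univ_weighted_segInt_eq_sum_Phi3plus]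
  -- the exponentially small term against `(ε/2)𝔓`
  have hexp : C * Real.exp (-c * ell D ^ 10) ≤ ε / 2 * frakP D := by
    have hℓ0 : 0 ≤ ell D := Real.log_natCast_nonneg D
    have he : Real.exp (-c * ell D ^ 10) ≤ 1 := by
      rw [Real.exp_le_one_iff]
      have : 0 ≤ c * ell D ^ 10 := by positivity
      linarith
    have hC : C * Real.exp (-c * ell D ^ 10) ≤ max C 0 := by
      calc C * Real.exp (-c * ell D ^ 10) ≤ max C 0 * Real.exp (-c * ell D ^ 10) :=
            mul_le_mul_of_nonneg_right (le_max_left _ _) (Real.exp_pos _).le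
        _ ≤ max C 0 * 1 := mul_le_mul_of_nonneg_left he (le_max_right _ _)
        _ = max C 0 := mul_one _
    have hD : max C 0 ≤ ε / 2 * D := by
      have h := mul_le_mul_of_nonneg_left hkey hε2.le
      calc max C 0 = ε / 2 * (2 * max C 0 / ε) := by field_simp
        _ ≤ ε / 2 * D := h
    calc C * Real.exp (-c * ell D ^ 10) ≤ max C 0 := hC
      _ ≤ ε / 2 * D := hD
      _ ≤ ε / 2 * frakP D := mul_le_mul_of_nonneg_left hPD hε2.le
  calc ‖S₁ - T‖ = ‖(S₁ - J₁) - J₂‖ := by rw [← hreg]; ring_nf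
    _ ≤ ‖S₁ - J₁‖ + ‖J₂‖ := norm_sub_le _ _
    _ ≤ C * Real.exp (-c * ell D ^ 10) + ε / 2 * frakP D := add_le_add haD hbD
    _ ≤ ε / 2 * frakP D + ε / 2 * frakP D := add_le_add hexp le_rfl
    _ = ε * frakP D := by ring

variable (c' : ℝ) in
/-- `Eq17_2` — `_holds` alias of `eq17_2_holds` above under the fact's exact name, stated under the
prover's own binders as section variables (appended 2026-08-28, D-0026 bookkeeping: the proof term is the
existing theorem of this file; no statement, definition or attribute is edited; no new named fact; the
ledger's debt table listed the fact unproved). [cite: Zhang2022LandauSiegel, §17 (17.2) p.95, tex L4711–L4716] -/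
theorem _root_.Literature.NumberTheory.LFunctions.Zhang2022.Typed.Section17.Eq17_2_holds :
    _root_.Literature.NumberTheory.LFunctions.Zhang2022.Typed.Section17.Eq17_2 c' :=
  _root_.Literature.NumberTheory.LFunctions.Zhang2022.Eq172.eq17_2_holds (c' := c')

end Literature.NumberTheory.LFunctions.Zhang2022.Eq172

namespace Literature.NumberTheory.LFunctions.Zhang2022.Typed.Section17

/-- **`Z22:(17.2)` DISCHARGED, by name** (every `c′`). [cite: Zhang2022LandauSiegel, §17 (17.2) p.95] -/
theorem eq17_2_holds (c' : ℝ) : Eq17_2 c' := Eq172.eq17_2_holds c'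

/-- **The leaf h17_6 reduced to §17.u007**: with (17.2) a theorem (`eq17_2_holds`), §17.u008 a theorem
(`step17_u008_holds`, every modulus) and the tree's edges `Phi3Eval.eq17_5_of`, `eq17_6_of`,
`eq17_6Rel_of_eq17_6`, the relative (17.6) `Typed.Section17.Eq17_6Rel c′` follows from the single
remaining §17 node `Step17_u007 c′` ("A detailed analysis shows that (17.2) [sc. (17.3)] remains valid
if … `κ₂(n₁)` is replaced by `(1∗μ)(n₁)`, … `χ(n₂n₃)(…)(…)` by `𝔢₀χ(n₂n₃)`, … `g̃₂(n₅)`, `g̃₃(n₆)` by `1`",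
p.96, tex L4735–L4747 — not carried out in print). [cite: Zhang2022LandauSiegel, §17 (17.6) p.96] -/
theorem eq17_6Rel_of_step17_u007 {c' : ℝ} (h7 : Step17_u007 c') : Eq17_6Rel c' :=
  (eq17_6Rel_iff c').mpr (Phi3Eval.eq17_6Rel_of_eq17_6
    (Phi3Eval.eq17_6_of (eq17_2_holds c') (Phi3Eval.eq17_5_of h7 fun _ _ χ => step17_u008_holds χ)))

end Literature.NumberTheory.LFunctions.Zhang2022.Typed.Section17

end
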